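import Summits.Ventures.CertifiedManyBodySolver.Observables.KineticWordD4
import Summits.Ventures.CertifiedManyBodySolver.Observables.StiffnessTLKineticTT
import Summits.Ventures.CertifiedManyBodySolver.Observables.StiffnessTLSeqCeiling
import Summits.Ventures.CertifiedManyBodySolver.Observables.RungLeavesStiffnessAnchor
import Summits.Ventures.CertifiedManyBodySolver.Observables.DiagHopChordRows
import Summits.Ventures.CertifiedManyBodySolver.Observables.StiffnessTLKineticCeilingURay
import HarnessLib

/-!
# Ventures/CertifiedManyBodySolver — Observables/StiffnessTLKineticTTOrbitDictionary.lean

HONEST FRAMING: one-sided CEILINGS on the uniform flux stiffness (f-sum class) and their CLASS FLOORS at any `t′`; a ceiling never speaks to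
the presence of order; not informative vs print; not a superconductivity verdict. Zero compute, no definition, no claim node, no `sorry`.

Cell `hubbard-obs` (D-0042), seat p2 (stiffness), `prover-hubbard-obs-p2-g10-0`. The `t′ ≠ 0` f-sum stiffness edges of the cell (registry row 22,
`OBS.rhos.tpm1o4.TLx5w5d2c3b4`: `ρ_s(8, 7/8, −¼) ≤ 0.3603604`) are certified `D₄`-ORBIT rows on `−X₀`, `X₀ = oddMomentObsTT t′ U 0 = ½Γ_ι k₀^{tt′}`
(`Observables/StiffnessTLKineticTT.lean`), read through the orbit tower `fluxStiffness_le_of_torusLimitTT'_oddMoment_orbit_certificate_seq`. What was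
missing (TARGET.md §2 R-0z′, «next p2 generation» since g0; p2 g9 «judged (a): ≈ 120 lines, skipped») is the DICTIONARY between that orbit functional
and the energy coordinates of hubbard-fast's program-free rows. This file proves it and draws the two consequences:

* §1–§2 `orbitMean_rotOddMomentLimitFunctionalTT_lam_zero` — for every translation-invariant `ω`:
  `|D₄|⁻¹ Σ_γ rotOddMomentLimitFunctionalTT t′ U 0 γ ω = −¼(K₁(ω) + 2t′K₂(ω)) = −¼ e_{Φ(1, 2t′, 0)}(ω)` (`…_eq_meanEnergy_twice_tPrime`) — the
  `D₄`-mean `x₁`-f-sum functional is a quarter of minus the ONE-BODY energy at DOUBLED diagonal hopping (transport of the embedded bond words,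
  `KineticWordD4`-style; orbit sums `d4_sum_e1/d1/d2`; bond flips by translation invariance; `K₂` bond form `meanEnergy_hubbardTTPrime_diagHop_eq_bondForm`).
* §3 `ObsStiffnessSeqCeilingAt_of_freeEnergyFloor_twice_tPrime` — **the density-specific KINEMATIC stiffness leaf at ANY `t′`**: a certified floor
  `ℓ ≤ e(1, 2t′, 0, n)` on the FREE energy at doubled `t′` (e.g. a hubbard-fast `fermiSeaCellRow_tPrime_<2t′>_density_<n>`) gives
  `ObsStiffnessSeqCeilingAt t′ U n c` for every `c ≥ −ℓ/4` (any `U`; the thermodynamic-limit variational inequality at the coupling `(1, 2t′, 0)`).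
  At `t′ = 0` this is `ObsStiffnessSeqCeilingAt_tp0_of_freeEnergyFloor` again; for the `t′ = ∓¼` anchors (A0/A2/A10/A9, A3) the input is a Fermi-sea row
  at `t″ = ∓½`, ASKED of hubbard-fast 2026-08-26 14:02Z (their M = 64 tables are private to `HubbardFermiSeaCellRows.lean`).
* §4 `orbitMean_oddMomentTT_lam_zero_ge_of_floors` / `oddMomentTT_lam_zero_classFloor_of_floors` — **the f-sum CLASS FLOOR at any `t′`** in energy
  coordinates: on the torus-limit ground-state class at `(U, n, t′)`, `|D₄|⁻¹ Σ_γ Re ω_γ(X₀) = ¼(U·D(ω) − e₀ − t′K₂(ω))`, so a docc floor `d_lo`, the cap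
  `e₀ ≤ hi` and a floor `B ≤ −t′K₂(ω)` (at `t′ < 0`: a FLOOR on `K₂`, e.g. the `t′`-chord of `Observables/DiagHopChordRows.lean`) give
  `¼(U·d_lo − hi + B) ≤` every certified upper bound on the orbit functional — no f-sum-route stiffness ceiling at that anchor can read below it.
  The A0 instance (`0.1499174`, from #445 ∧ #257 ∧ #473) is in `Certificates/HubbardSquare_n7o8_stiffness_tpm1o4_classfloor.lean`.

References: T. Hazra, N. Verma, M. Randeria, PRX 9 (2019) 031049, eq. (4) [HazraVermaRanderia2019]; D. J. Scalapino, S. R. White, S.-C. Zhang,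
PRB 47 (1993) 7995, §II [ScalapinoWhiteZhang1993]; O. Bratteli, D. W. Robinson, *Operator Algebras and QSM 2* (1997) §6.2.4 [BratteliRobinsonII1997];
E. H. Lieb, M. Loss, Duke Math. J. 71 (1993) 337, §8 [LiebLoss1993]; T. Koma, H. Tasaki, J. Stat. Phys. 76 (1994) 745, §1 [KomaTasaki1994].
-/

noncomputable section

namespace Summit.Ventures.CertifiedManyBodySolver.Observables

open Literature.MathematicalPhysics.QuantumLattice
open Literature.MathematicalPhysics.QuantumLattice.ThermodynamicLimit
open Literature.MathematicalPhysics.QuantumFieldTheory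
open Literature.Probability.LatticeModels
open Summit.Ventures.CertifiedManyBodySolver.Transport
open Matrix Finset Filter Topology HubbardWave0
open scoped Matrix BigOperators ComplexOrder

/-! ## §1 Transport of the embedded bond words under `D₄`, and the orbit sums -/

/-- **Transport of one embedded hopping word** `c†_{0σ} c_{vσ}` (`v ∈ [-1,1]²`, embedded `[-1,1]² ⊆ [-7,7]²`, then moved by `Γ(d4Emb γ 0 [-7,7]²)`):
its expectation is the bond expectation `Re ω_{{0,γv}}(c†_{0σ} c_{γv,σ})` (`Γ(d4Emb) c_{xσ} = c_{γx,σ}`, isotony). The `[-1,1]² ⊆ [-7,7]²` twin of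
`re_expect_d4Emb_hopWord` (`Observables/KineticWordD4.lean`). [cite: BratteliRobinsonII1997, §6.2.4] -/
theorem re_expect_d4Emb_incl_hop (ω : InfVolFermionState 2) (γ : DihedralGroup 4) (h17 : box 2 1 ⊆ box 2 7)
    (v : Site 2) (hv : v ∈ box 2 1) (σ : Fin 2) :
    (ω.expect (d4ShiftSet γ 0 (box 2 7)) (fermionEmbed (PolySite.d4Emb γ 0 (box 2 7))
        (fermionEmbed (PolySite.incl h17) ((cAt 0 zero_mem_box_one σ)ᴴ * cAt v hv σ)))).re =
      (ω.expect ({0, d4Vec γ v} : Finset (Site 2))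
        ((cAt 0 (mem_insert_self _ _) σ)ᴴ * cAt (d4Vec γ v) (mem_insert_of_mem (mem_singleton_self _)) σ)).re := by
  have h0 : d4Vec γ (0 : Site 2) + 0 = 0 := by rw [add_zero, (d4Vec_eq_zero_iff γ 0).2 rfl]
  have hv' : d4Vec γ v + 0 = d4Vec γ v := add_zero _
  have hsub : ({0, d4Vec γ v} : Finset (Site 2)) ⊆ d4ShiftSet γ 0 (box 2 7) := by
    intro z hz
    rcases mem_insert.1 hz with rfl | hz
    · have h := d4Vec_add_mem_d4ShiftSet γ 0 (h17 zero_mem_box_one)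
      rwa [h0] at h
    · rw [mem_singleton.1 hz]
      have h := d4Vec_add_mem_d4ShiftSet γ 0 (h17 hv)
      rwa [hv'] at h
  have h1 : fermionEmbed (PolySite.d4Emb γ 0 (box 2 7)) (fermionEmbed (PolySite.incl h17) (cAt 0 zero_mem_box_one σ)) =
      cAt 0 (hsub (mem_insert_self _ _)) σ := by
    rw [fermionEmbed_incl_cAt]
    exact (fermionEmbed_annihilation _ _ _).trans (cAt_congr (d4Vec_add_mem_d4ShiftSet γ 0 (h17 zero_mem_box_one)) _ h0 σ)
  have h2 : fermionEmbed (PolySite.d4Emb γ 0 (box 2 7)) (fermionEmbed (PolySite.incl h17) (cAt v hv σ)) =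
      cAt (d4Vec γ v) (hsub (mem_insert_of_mem (mem_singleton_self _))) σ := by
    rw [fermionEmbed_incl_cAt]
    exact (fermionEmbed_annihilation _ _ _).trans (cAt_congr (d4Vec_add_mem_d4ShiftSet γ 0 (h17 hv)) _ hv' σ)
  have hw : fermionEmbed (PolySite.d4Emb γ 0 (box 2 7))
        (fermionEmbed (PolySite.incl h17) ((cAt 0 zero_mem_box_one σ)ᴴ * cAt v hv σ)) =
      fermionEmbed (PolySite.incl hsub)
        ((cAt 0 (mem_insert_self _ _) σ)ᴴ * cAt (d4Vec γ v) (mem_insert_of_mem (mem_singleton_self _)) σ) := by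
    rw [map_mul, map_mul, fermionEmbed_conjTranspose, fermionEmbed_conjTranspose, h1, h2, map_mul,
      fermionEmbed_conjTranspose, fermionEmbed_incl_cAt, fermionEmbed_incl_cAt]
  rw [hw, ω.compatible hsub]

/-- **Transport of the reversed word** `c†_{vσ} c_{0σ}`: the same bond expectation (states are Hermitian on a bond, `re_expect_hop_swap`).
[cite: BratteliRobinsonII1997, §6.2.4] -/
theorem re_expect_d4Emb_incl_hop_rev (ω : InfVolFermionState 2) (γ : DihedralGroup 4) (h17 : box 2 1 ⊆ box 2 7)
    (v : Site 2) (hv : v ∈ box 2 1) (σ : Fin 2) :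
    (ω.expect (d4ShiftSet γ 0 (box 2 7)) (fermionEmbed (PolySite.d4Emb γ 0 (box 2 7))
        (fermionEmbed (PolySite.incl h17) ((cAt v hv σ)ᴴ * cAt 0 zero_mem_box_one σ)))).re =
      (ω.expect ({0, d4Vec γ v} : Finset (Site 2))
        ((cAt 0 (mem_insert_self _ _) σ)ᴴ * cAt (d4Vec γ v) (mem_insert_of_mem (mem_singleton_self _)) σ)).re := by
  have h0 : d4Vec γ (0 : Site 2) + 0 = 0 := by rw [add_zero, (d4Vec_eq_zero_iff γ 0).2 rfl]
  have hv' : d4Vec γ v + 0 = d4Vec γ v := add_zero _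
  have hsub : ({0, d4Vec γ v} : Finset (Site 2)) ⊆ d4ShiftSet γ 0 (box 2 7) := by
    intro z hz
    rcases mem_insert.1 hz with rfl | hz
    · have h := d4Vec_add_mem_d4ShiftSet γ 0 (h17 zero_mem_box_one)
      rwa [h0] at h
    · rw [mem_singleton.1 hz]
      have h := d4Vec_add_mem_d4ShiftSet γ 0 (h17 hv)
      rwa [hv'] at h
  have h1 : fermionEmbed (PolySite.d4Emb γ 0 (box 2 7)) (fermionEmbed (PolySite.incl h17) (cAt 0 zero_mem_box_one σ)) =
      cAt 0 (hsub (mem_insert_self _ _)) σ := by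
    rw [fermionEmbed_incl_cAt]
    exact (fermionEmbed_annihilation _ _ _).trans (cAt_congr (d4Vec_add_mem_d4ShiftSet γ 0 (h17 zero_mem_box_one)) _ h0 σ)
  have h2 : fermionEmbed (PolySite.d4Emb γ 0 (box 2 7)) (fermionEmbed (PolySite.incl h17) (cAt v hv σ)) =
      cAt (d4Vec γ v) (hsub (mem_insert_of_mem (mem_singleton_self _))) σ := by
    rw [fermionEmbed_incl_cAt]
    exact (fermionEmbed_annihilation _ _ _).trans (cAt_congr (d4Vec_add_mem_d4ShiftSet γ 0 (h17 hv)) _ hv' σ)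
  have hw : fermionEmbed (PolySite.d4Emb γ 0 (box 2 7))
        (fermionEmbed (PolySite.incl h17) ((cAt v hv σ)ᴴ * cAt 0 zero_mem_box_one σ)) =
      fermionEmbed (PolySite.incl hsub)
        ((cAt (d4Vec γ v) (mem_insert_of_mem (mem_singleton_self _)) σ)ᴴ * cAt 0 (mem_insert_self _ _) σ) := by
    rw [map_mul, map_mul, fermionEmbed_conjTranspose, fermionEmbed_conjTranspose, h1, h2, map_mul,
      fermionEmbed_conjTranspose, fermionEmbed_incl_cAt, fermionEmbed_incl_cAt]
  rw [hw, ω.compatible hsub]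
  exact re_expect_hop_swap ω (d4Vec γ v) σ

/-- `j₀ = diagVec 0 = (1, 1)` in matrix notation. [folklore] -/
theorem diagVec_zero_eq' : (diagVec 0 : Site 2) = ![1, 1] := by
  funext j; fin_cases j <;> simp [diagVec]

/-- `j₁ = diagVec 1 = (1, −1)` in matrix notation. [folklore] -/
theorem diagVec_one_eq' : (diagVec 1 : Site 2) = ![1, -1] := by
  funext j; fin_cases j <;> simp [diagVec]

/-- **Orbit sum over a diagonal vector** for a flip-symmetric bond function (`F(−v) = F(v)`): `Σ_γ F(γ j_s) = 4(F(j₀) + F(j₁))` — the orbit of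
`j_s` is `{(±1, ±1)}`, each twice (`d4_sum_d1/d2`, Transport/D4VecAction.lean), and `(−1,−1) = −j₀`, `(−1,1) = −j₁`. [folklore] -/
theorem d4_sum_diagVec_of_flip (F : Site 2 → ℝ) (hflip : ∀ v : Site 2, F (-v) = F v) (s : Fin 2) :
    ∑ γ : DihedralGroup 4, F (d4Vec γ (diagVec s)) = 4 * (F (diagVec 0) + F (diagVec 1)) := by
  have hn0 : (![-1, -1] : Site 2) = -![1, 1] := by decide
  have hn1 : (![-1, 1] : Site 2) = -![1, -1] := by decide
  have hs : s = 0 ∨ s = 1 := by fin_cases s <;> simp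
  rw [diagVec_zero_eq', diagVec_one_eq']
  rcases hs with rfl | rfl
  · rw [diagVec_zero_eq', d4_sum_d1, hn0, hn1, hflip, hflip]; ring
  · rw [diagVec_one_eq', d4_sum_d2, hn0, hn1, hflip, hflip]; ring

/-- **Orbit sum over `e₁`** for a flip-symmetric bond function: `Σ_γ F(γ e₁) = 4(F(e₁) + F(e₂))` (`d4_sum_e1`). [folklore] -/
theorem d4_sum_unitVec_zero_of_flip (F : Site 2 → ℝ) (hflip : ∀ v : Site 2, F (-v) = F v) :
    ∑ γ : DihedralGroup 4, F (d4Vec γ (unitVec 0)) = 4 * (F (unitVec 0) + F (unitVec 1)) := by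
  have hn1 : (![-1, 0] : Site 2) = -![1, 0] := by decide
  have hn2 : (![0, -1] : Site 2) = -![0, 1] := by decide
  rw [unitVec_zero_eq, unitVec_one_eq, d4_sum_e1, hn1, hn2, hflip, hflip]; ring

/-- Expectation of the transported embedded `t–t'` kinetic bond observable, bond by bond. -/
theorem re_expect_d4Emb_incl_kinBondObsTT (ω : InfVolFermionState 2) (γ : DihedralGroup 4) (h17 : box 2 1 ⊆ box 2 7)
    (tp : ℝ) :
    (ω.expect (d4ShiftSet γ 0 (box 2 7)) (fermionEmbed (PolySite.d4Emb γ 0 (box 2 7))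
        (fermionEmbed (PolySite.incl h17) (kinBondObsTT tp)))).re =
      ∑ σ : Fin 2, 2 * (ω.expect ({0, d4Vec γ (unitVec 0)} : Finset (Site 2))
          ((cAt 0 (mem_insert_self _ _) σ)ᴴ * cAt (d4Vec γ (unitVec 0)) (mem_insert_of_mem (mem_singleton_self _)) σ)).re +
        tp * ∑ s : Fin 2, ∑ σ : Fin 2, 2 * (ω.expect ({0, d4Vec γ (diagVec s)} : Finset (Site 2))
          ((cAt 0 (mem_insert_self _ _) σ)ᴴ * cAt (d4Vec γ (diagVec s)) (mem_insert_of_mem (mem_singleton_self _)) σ)).re := by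
  unfold kinBondObsTT kinBondObs
  simp only [map_add, map_sum, map_smul, smul_eq_mul, Complex.add_re, Complex.re_sum,
    Complex.re_ofReal_mul, re_expect_d4Emb_incl_hop, re_expect_d4Emb_incl_hop_rev]
  ring

/-- **DICTIONARY (translation-invariant `ω`).** The `D₄`-orbit mean of the `λ = 0` odd-moment limit functional — the functional whose certified
orbit rows are the cell's `kinx` stiffness edges at `t′ ≠ 0` (`rotOddMomentLimitFunctionalTT t′ U 0 γ ω = Re ω_{γΛ₇}(Γ_γ X₀)`, `X₀ = ½Γ_ι k₀^{tt′}`) — is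
`|D₄|⁻¹ Σ_γ Re ω_{γΛ₇}(Γ_γ X₀) = −¼·(K₁(ω) + 2t′·K₂(ω))`, `K₁ = e_{Φ(1,0,0)}` the nearest-neighbour and `K₂ = e_{Φ(0,1,0)}` the unit diagonal hopping
energy per site: the diagonal bonds ALL advance in `x₁`, so they enter the `x₁`-f-sum with weight `t′` against `½` for the nearest-neighbour bonds,
i.e. with RELATIVE weight `2t′` (TARGET.md §2 R-0z′: «𝒦ˣ + 𝒦ʸ = −H_hop + t′·K_d»). [cite: HazraVermaRanderia2019, eq. (4)] [cite: ScalapinoWhiteZhang1993, §II] -/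
theorem orbitMean_rotOddMomentLimitFunctionalTT_lam_zero {ω : InfVolFermionState 2} (hω : ω.IsTranslationInvariant)
    (tp U : ℝ) :
    ((Finset.univ : Finset (DihedralGroup 4)).card : ℝ)⁻¹ *
        ∑ γ ∈ (Finset.univ : Finset (DihedralGroup 4)), rotOddMomentLimitFunctionalTT tp U 0 γ ω =
      -(1 / 4) * (ω.meanEnergy (hubbardTTPrimeFermionInteraction 1 0 0) 1 +
        2 * tp * ω.meanEnergy (hubbardTTPrimeFermionInteraction 0 1 0) 1) := by
  have hcard : ((Finset.univ : Finset (DihedralGroup 4)).card : ℝ) = 8 := by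
    rw [Finset.card_univ]; exact_mod_cast (by decide : Fintype.card (DihedralGroup 4) = 8)
  -- the bond function and its flip symmetry
  set F : Fin 2 → Site 2 → ℝ := fun σ v => (ω.expect ({0, v} : Finset (Site 2))
      ((cAt 0 (mem_insert_self _ _) σ)ᴴ * cAt v (mem_insert_of_mem (mem_singleton_self _)) σ)).re with hF
  have hflip : ∀ σ (v : Site 2), F σ (-v) = F σ v := fun σ v => by
    simp only [hF]; exact re_expect_hop_neg hω v σ
  -- each rotated copy, bond by bond
  have hexp : ∀ γ : DihedralGroup 4, rotOddMomentLimitFunctionalTT tp U 0 γ ω =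
      (1 / 2) * (∑ σ : Fin 2, 2 * F σ (d4Vec γ (unitVec 0)) + tp * ∑ s : Fin 2, ∑ σ : Fin 2, 2 * F σ (d4Vec γ (diagVec s))) := by
    intro γ
    unfold rotOddMomentLimitFunctionalTT
    rw [oddMomentObsTT_lam_zero, fermionEmbed_smul, map_smul, smul_eq_mul, Complex.re_ofReal_mul,
      re_expect_d4Emb_incl_kinBondObsTT]
  simp_rw [hexp]
  -- the orbit sums
  have hs1 : ∀ σ : Fin 2, ∑ γ : DihedralGroup 4, F σ (d4Vec γ (unitVec 0)) = 4 * (F σ (unitVec 0) + F σ (unitVec 1)) :=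
    fun σ => d4_sum_unitVec_zero_of_flip (F σ) (hflip σ)
  have hs2 : ∀ (s : Fin 2) (σ : Fin 2), ∑ γ : DihedralGroup 4, F σ (d4Vec γ (diagVec s)) =
      4 * (F σ (diagVec 0) + F σ (diagVec 1)) := fun s σ => d4_sum_diagVec_of_flip (F σ) (hflip σ) s
  have hsum : ∑ γ ∈ (Finset.univ : Finset (DihedralGroup 4)),
      (1 / 2 : ℝ) * (∑ σ : Fin 2, 2 * F σ (d4Vec γ (unitVec 0)) + tp * ∑ s : Fin 2, ∑ σ : Fin 2, 2 * F σ (d4Vec γ (diagVec s))) =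
      4 * ∑ σ : Fin 2, (F σ (unitVec 0) + F σ (unitVec 1)) + 8 * tp * ∑ σ : Fin 2, (F σ (diagVec 0) + F σ (diagVec 1)) := by
    rw [← Finset.mul_sum, Finset.sum_add_distrib, ← Finset.mul_sum, Finset.sum_comm]
    simp_rw [← Finset.mul_sum, hs1]
    rw [Finset.sum_comm]
    simp_rw [Finset.sum_comm (s := (Finset.univ : Finset (DihedralGroup 4))) (t := (Finset.univ : Finset (Fin 2))),
      ← Finset.mul_sum, hs2]
    simp only [Fin.sum_univ_two]
    ring
  rw [hsum, hcard]
  -- the energy coordinates in bond form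
  have hK1 : ω.meanEnergy (hubbardTTPrimeFermionInteraction 1 0 0) 1 = -2 * ∑ σ : Fin 2, (F σ (unitVec 0) + F σ (unitVec 1)) := by
    rw [meanEnergy_hubbardTTPrime_oneBody_eq_kineticDensity hω]
    simp only [Fin.sum_univ_two]
    rw [show (0 : Site 2) + unitVec 0 = unitVec 0 from zero_add _, show (0 : Site 2) + unitVec 1 = unitVec 1 from zero_add _]
    simp only [hF, re_expect_hop_swap]
    ring
  have hK2 : ω.meanEnergy (hubbardTTPrimeFermionInteraction 0 1 0) 1 = -2 * ∑ σ : Fin 2, (F σ (diagVec 0) + F σ (diagVec 1)) := by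
    rw [meanEnergy_hubbardTTPrime_diagHop_eq_bondForm hω]
    simp only [Fin.sum_univ_two]
    rw [show (0 : Site 2) + diagVec 0 = diagVec 0 from zero_add _, show (0 : Site 2) + diagVec 1 = diagVec 1 from zero_add _]
    simp only [hF, re_expect_hop_swap]
    ring
  rw [hK1, hK2]
  ring

/-- **The orbit mean as ONE energy coordinate**: for translation-invariant `ω`,
`|D₄|⁻¹ Σ_γ rotOddMomentLimitFunctionalTT t′ U 0 γ ω = −¼·e_{Φ(1, 2t′, 0)}(ω)` — a quarter of minus the mean energy per site of `ω` for the FREE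
`t–t″` Hamiltonian at DOUBLED diagonal hopping `t″ = 2t′` (`meanEnergy_hubbardTTPrime_eq_coords`). [cite: HazraVermaRanderia2019, eq. (4)] -/
theorem orbitMean_rotOddMomentLimitFunctionalTT_lam_zero_eq_meanEnergy_twice_tPrime {ω : InfVolFermionState 2}
    (hω : ω.IsTranslationInvariant) (tp U : ℝ) :
    ((Finset.univ : Finset (DihedralGroup 4)).card : ℝ)⁻¹ *
        ∑ γ ∈ (Finset.univ : Finset (DihedralGroup 4)), rotOddMomentLimitFunctionalTT tp U 0 γ ω =
      -(1 / 4) * ω.meanEnergy (hubbardTTPrimeFermionInteraction 1 (2 * tp) 0) 1 := by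
  rw [orbitMean_rotOddMomentLimitFunctionalTT_lam_zero hω, InfVolFermionState.meanEnergy_hubbardTTPrime_eq_coords ω 1 (2 * tp) 0]
  ring

/-! ## §3 The density-specific kinematic stiffness leaf at ANY `t′` from a free-energy floor at `2t′` -/

/-- **KINEMATIC STIFFNESS LEAF AT ANY `t′`.** `0 ≤ n < 2`, any `t′`, `U`; if `ℓ ≤ e(1, 2t′, 0, n)` (a certified floor on the FREE energy density at
doubled diagonal hopping) then `ObsStiffnessSeqCeilingAt t′ U n c` for every rational `c ≥ −ℓ/4`: every flux stiffness `ρ_s > 0` (scale `θ₀ > 0`) of the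
zero-flux `(rectN n L, S^z = 0)` sectors of `hubbardTorusTT' L 1 t′ U` whose flux inequality holds along some sequence of sides satisfies `ρ_s ≤ −ℓ/4`.
Proof: the orbit tower at `λ = 0`, `S = D₄` (`fluxStiffness_le_of_torusLimitTT'_oddMoment_orbit_certificate_seq`) with the certificate
`|D₄|⁻¹Σ_γ Re ω_γ(X₀) = −¼e_{Φ(1,2t′,0)}(ω) ≤ −¼e(1,2t′,0,n) ≤ −ℓ/4` (§2 + `IsTorusLimitOf.energyDensityTT'_le_meanEnergy_hubbardTTPrime`).
[cite: ScalapinoWhiteZhang1993, §II] [cite: LiebLoss1993, §8, Theorem 8.2] -/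
theorem ObsStiffnessSeqCeilingAt_of_freeEnergyFloor_twice_tPrime (tp : ℝ) {U n : ℝ} (hn0 : 0 ≤ n) (hn2 : n < 2)
    {ℓ : ℝ} (hℓ : ℓ ≤ energyDensityTT' 1 (2 * tp) 0 n) (c : ℚ) (hc : -ℓ / 4 ≤ ((c : ℚ) : ℝ)) :
    ObsStiffnessSeqCeilingAt tp U n c := by
  intro ρs θ₀ _ hθ₀ Ls hLs hst
  refine (fluxStiffness_le_of_torusLimitTT'_oddMoment_orbit_certificate_seq tp (U := U) (δ := 1 - n) (q := -ℓ / 4) 0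
    Finset.univ Finset.univ_nonempty (by linarith) (by linarith) hθ₀ hLs hst ?_).trans hc
  intro ω Ms ψ hMs hψ h1 hω
  have hψ' : ∀ j, IsGroundStateInSector (hubbardTorusTT' (Ms j) 1 tp U) (rectN n (Ms j)) 0 (ψ (Ms j)) := fun j => by
    simpa only [sub_sub_cancel] using hψ j
  have hN : ∀ j, IsNParticle (rectN n (Ms j)) (ψ (Ms j)) := fun j => ((mem_szSector_iff _ _ _).1 (hψ' j).1).1
  rw [orbitMean_rotOddMomentLimitFunctionalTT_lam_zero_eq_meanEnergy_twice_tPrime hω.isTranslationInvariant]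
  have h := hω.energyDensityTT'_le_meanEnergy_hubbardTTPrime 1 (2 * tp) (U := 0) le_rfl hn0 hn2 hMs hN h1
  linarith

/-- The all-even-sides form. [cite: ScalapinoWhiteZhang1993, §II] -/
theorem ObsStiffnessCeilingAt_of_freeEnergyFloor_twice_tPrime (tp : ℝ) {U n : ℝ} (hn0 : 0 ≤ n) (hn2 : n < 2)
    {ℓ : ℝ} (hℓ : ℓ ≤ energyDensityTT' 1 (2 * tp) 0 n) (c : ℚ) (hc : -ℓ / 4 ≤ ((c : ℚ) : ℝ)) :
    ObsStiffnessCeilingAt tp U n c :=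
  (ObsStiffnessSeqCeilingAt_of_freeEnergyFloor_twice_tPrime tp (U := U) hn0 hn2 hℓ c hc).ceilingAt

/-! ## §4 The f-sum CLASS FLOOR at any `t′`, in energy coordinates -/

/-- **The orbit functional on the torus-limit ground-state class, in energy coordinates.** For a torus limit `ω` of unit
`(rectN n L, S^z = 0)`-sector ground states of `hubbardTorusTT' L 1 t′ U` (`U ≥ 0`, `0 ≤ n < 2`):
`|D₄|⁻¹ Σ_γ Re ω_γ(X₀) = ¼(U·Re ω(n↑n↓) − e(1,t′,U,n) − t′·K₂(ω))` (`K₁ + t′K₂ + U·D = e₀` on the class). [cite: KomaTasaki1994, §1] -/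
theorem orbitMean_rotOddMomentLimitFunctionalTT_lam_zero_eq_docc_energy_diagHop (tp : ℝ) {U n : ℝ} (hU : 0 ≤ U)
    (hn0 : 0 ≤ n) (hn2 : n < 2)
    {ω : InfVolFermionState 2} {ψ : ∀ L, Fock (Orb (FermionTorus 2 L))} {Ls : ℕ → ℕ}
    (hω : ω.IsTorusLimitOf ψ Ls) (hLs : Tendsto Ls atTop atTop)
    (hψ : ∀ j, IsGroundStateInSector (hubbardTorusTT' (Ls j) 1 tp U) (rectN n (Ls j)) 0 (ψ (Ls j)))
    (h1 : ∀ j, star (ψ (Ls j)) ⬝ᵥ ψ (Ls j) = 1) :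
    ((Finset.univ : Finset (DihedralGroup 4)).card : ℝ)⁻¹ *
        ∑ γ ∈ (Finset.univ : Finset (DihedralGroup 4)), rotOddMomentLimitFunctionalTT tp U 0 γ ω =
      (1 / 4) * (U * (ω.expect ({0} : Finset (Site 2))
          (nAt 0 (Finset.mem_singleton_self 0) 0 * nAt 0 (Finset.mem_singleton_self 0) 1)).re -
        energyDensityTT' 1 tp U n - tp * ω.meanEnergy (hubbardTTPrimeFermionInteraction 0 1 0) 1) := by
  rw [orbitMean_rotOddMomentLimitFunctionalTT_lam_zero hω.isTranslationInvariant,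
    ← hω.meanEnergy_hubbardTTPrime_eq_energyDensityTT' 1 tp hU hn0 hn2 hLs hψ h1,
    InfVolFermionState.meanEnergy_hubbardTTPrime_eq_coords ω 1 tp U, ← hω.meanEnergy_onSite_eq_re_expect_docc hLs]
  ring

/-- **Floor on the orbit functional from three floors/caps** (torus-limit ground state at `(U, n, t′)`, `U ≥ 0`, `0 ≤ n < 2`): a docc floor
`d_lo ≤ Re ω(n↑n↓)`, the cap `e(1,t′,U,n) ≤ hi`, and `B ≤ −t′·K₂(ω)` give `¼(U·d_lo − hi + B) ≤ |D₄|⁻¹ Σ_γ Re ω_γ(X₀)`. [cite: KomaTasaki1994, §1] -/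
theorem orbitMean_oddMomentTT_lam_zero_ge_of_floors (tp : ℝ) {U n : ℝ} (hU : 0 ≤ U) (hn0 : 0 ≤ n) (hn2 : n < 2)
    {ω : InfVolFermionState 2} {ψ : ∀ L, Fock (Orb (FermionTorus 2 L))} {Ls : ℕ → ℕ}
    (hω : ω.IsTorusLimitOf ψ Ls) (hLs : Tendsto Ls atTop atTop)
    (hψ : ∀ j, IsGroundStateInSector (hubbardTorusTT' (Ls j) 1 tp U) (rectN n (Ls j)) 0 (ψ (Ls j)))
    (h1 : ∀ j, star (ψ (Ls j)) ⬝ᵥ ψ (Ls j) = 1)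
    {dlo hi B : ℝ}
    (hd : dlo ≤ (ω.expect ({0} : Finset (Site 2))
        (nAt 0 (Finset.mem_singleton_self 0) 0 * nAt 0 (Finset.mem_singleton_self 0) 1)).re)
    (hhi : energyDensityTT' 1 tp U n ≤ hi) (hB : B ≤ -tp * ω.meanEnergy (hubbardTTPrimeFermionInteraction 0 1 0) 1) :
    (1 / 4) * (U * dlo - hi + B) ≤ ((Finset.univ : Finset (DihedralGroup 4)).card : ℝ)⁻¹ *
        ∑ γ ∈ (Finset.univ : Finset (DihedralGroup 4)), rotOddMomentLimitFunctionalTT tp U 0 γ ω := by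
  rw [orbitMean_rotOddMomentLimitFunctionalTT_lam_zero_eq_docc_energy_diagHop tp hU hn0 hn2 hω hLs hψ h1]
  have hUd : U * dlo ≤ U * (ω.expect ({0} : Finset (Site 2))
      (nAt 0 (Finset.mem_singleton_self 0) 0 * nAt 0 (Finset.mem_singleton_self 0) 1)).re := mul_le_mul_of_nonneg_left hd hU
  linarith

/-- **f-sum CLASS FLOOR at `(U, n, t′)` in energy coordinates.** `U ≥ 0`, `0 ≤ n < 2`. Suppose that on the WHOLE torus-limit ground-state class at
`(U, n, t′)` a docc floor `d_lo ≤ Re ω(n↑n↓)`, the cap `e₀ ≤ hi` and `B ≤ −t′K₂(ω)` hold, and that `q` bounds the `D₄`-orbit f-sum functional from above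
on the class (`|D₄|⁻¹ Σ_γ Re ω_γ(X₀) ≤ q` — what ANY certified `kinx` edge delivers: a row `r ≤ |D₄|⁻¹ Σ_γ Re ω_γ(−X₀)` gives `q = −r`, the stiffness
reading being `ρ_s ≤ −r`). Then `¼(U·d_lo − hi + B) ≤ q` (the class is inhabited, `exists_isTorusLimitOf_sectorGroundState_TT'`): no f-sum-route
stiffness ceiling at that anchor can read below `¼(U·d_lo − hi + B)`. [cite: KomaTasaki1994, §1] [cite: BratteliRobinsonII1997, §6.2.4] -/
theorem oddMomentTT_lam_zero_classFloor_of_floors (tp : ℝ) {U n : ℝ} (hU : 0 ≤ U) (hn0 : 0 ≤ n) (hn2 : n < 2) {dlo hi B q : ℝ}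
    (hhi : energyDensityTT' 1 tp U n ≤ hi)
    (hd : ∀ (ω : InfVolFermionState 2) (Ls : ℕ → ℕ) (ψ : ∀ L, Fock (Orb (FermionTorus 2 L))),
      Tendsto Ls atTop atTop →
      (∀ j, IsGroundStateInSector (hubbardTorusTT' (Ls j) 1 tp U) (rectN n (Ls j)) 0 (ψ (Ls j))) →
      (∀ j, star (ψ (Ls j)) ⬝ᵥ ψ (Ls j) = 1) → ω.IsTorusLimitOf ψ Ls →
      dlo ≤ (ω.expect ({0} : Finset (Site 2))
        (nAt 0 (Finset.mem_singleton_self 0) 0 * nAt 0 (Finset.mem_singleton_self 0) 1)).re)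
    (hB : ∀ (ω : InfVolFermionState 2) (Ls : ℕ → ℕ) (ψ : ∀ L, Fock (Orb (FermionTorus 2 L))),
      Tendsto Ls atTop atTop →
      (∀ j, IsGroundStateInSector (hubbardTorusTT' (Ls j) 1 tp U) (rectN n (Ls j)) 0 (ψ (Ls j))) →
      (∀ j, star (ψ (Ls j)) ⬝ᵥ ψ (Ls j) = 1) → ω.IsTorusLimitOf ψ Ls →
      B ≤ -tp * ω.meanEnergy (hubbardTTPrimeFermionInteraction 0 1 0) 1)
    (hq : ∀ (ω : InfVolFermionState 2) (Ls : ℕ → ℕ) (ψ : ∀ L, Fock (Orb (FermionTorus 2 L))),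
      Tendsto Ls atTop atTop →
      (∀ j, IsGroundStateInSector (hubbardTorusTT' (Ls j) 1 tp U) (rectN n (Ls j)) 0 (ψ (Ls j))) →
      (∀ j, star (ψ (Ls j)) ⬝ᵥ ψ (Ls j) = 1) → ω.IsTorusLimitOf ψ Ls →
      ((Finset.univ : Finset (DihedralGroup 4)).card : ℝ)⁻¹ *
        ∑ γ ∈ (Finset.univ : Finset (DihedralGroup 4)), rotOddMomentLimitFunctionalTT tp U 0 γ ω ≤ q) :
    (1 / 4) * (U * dlo - hi + B) ≤ q := by
  obtain ⟨ψ, φ, ω, hφ, hψ, hψ1, hω, -, -, -⟩ :=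
    exists_isTorusLimitOf_sectorGroundState_TT' 1 tp U hn0 hn2.le (Ls := id) tendsto_id
  have hLφ : Tendsto (id ∘ φ : ℕ → ℕ) atTop atTop := tendsto_id.comp hφ.tendsto_atTop
  exact (orbitMean_oddMomentTT_lam_zero_ge_of_floors tp hU hn0 hn2 hω hLφ (fun j => hψ _) (fun j => hψ1 _)
    (hd ω (id ∘ φ) ψ hLφ (fun j => hψ _) (fun j => hψ1 _) hω) hhi
    (hB ω (id ∘ φ) ψ hLφ (fun j => hψ _) (fun j => hψ1 _) hω)).trans
    (hq ω (id ∘ φ) ψ hLφ (fun j => hψ _) (fun j => hψ1 _) hω)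

/-- **A certified orbit row is such a `q`**: `SquareTTPrimeCorrOrbitLowerRow t′ U n u r univ (box 2 7) (−oddMomentObsTT t′ U 0)` with the cap
`e₀ ≤ u` gives `|D₄|⁻¹ Σ_γ Re ω_γ(X₀) ≤ −r` on the class (linearity of transport and expectation in the observable). [cite: ScalapinoWhiteZhang1993, §II] -/
theorem orbitMean_oddMomentTT_lam_zero_le_neg_of_orbitLowerRow (tp : ℝ) {U n : ℝ} {u r : ℚ}
    (hrow : SquareTTPrimeCorrOrbitLowerRow tp U n u r Finset.univ (box 2 7) (-oddMomentObsTT tp U 0))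
    (hu : energyDensityTT' 1 tp U n ≤ ((u : ℚ) : ℝ)) :
    ∀ (ω : InfVolFermionState 2) (Ls : ℕ → ℕ) (ψ : ∀ L, Fock (Orb (FermionTorus 2 L))),
      Tendsto Ls atTop atTop →
      (∀ j, IsGroundStateInSector (hubbardTorusTT' (Ls j) 1 tp U) (rectN n (Ls j)) 0 (ψ (Ls j))) →
      (∀ j, star (ψ (Ls j)) ⬝ᵥ ψ (Ls j) = 1) → ω.IsTorusLimitOf ψ Ls →
      ((Finset.univ : Finset (DihedralGroup 4)).card : ℝ)⁻¹ *
        ∑ γ ∈ (Finset.univ : Finset (DihedralGroup 4)), rotOddMomentLimitFunctionalTT tp U 0 γ ω ≤ -((r : ℚ) : ℝ) := by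
  intro ω Ls ψ hLs hψ h1 hω
  have h := hrow ω Ls ψ hLs hψ h1 hω hu
  have hneg : ∀ γ : DihedralGroup 4,
      (ω.expect (d4ShiftSet γ 0 (box 2 7)) (fermionEmbed (PolySite.d4Emb γ 0 (box 2 7)) (-oddMomentObsTT tp U 0))).re =
        -rotOddMomentLimitFunctionalTT tp U 0 γ ω := by
    intro γ
    unfold rotOddMomentLimitFunctionalTT
    rw [map_neg, map_neg, Complex.neg_re]
  simp_rw [hneg, Finset.sum_neg_distrib, mul_neg] at h
  linarith

end Summit.Ventures.CertifiedManyBodySolver.Observables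

end
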